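import Summits.QuantumFields.BalabanUV.Beta.StepResidualPair
import Summits.QuantumFields.BalabanUV.Beta.BubbleParity

/-!
# RULES 3–4 OF THE RELATIVE INVERSE AT EVERY STEP `j ≥ 1`: the block-mean co-dressed decimated composite resolvent inverts the
# step candidate on the range of the coarse axial coordinate projector —
# `RelInv (Π̂_bmᵀ (KInvStep Lc (j+1)) Π̂_bm) (bhKStepAt 3 ρ_c Lc (j+1)) (axEc ρ_c Lc)`
# (β sub-cell, row BETA-an2 = BINDER-OWNERS row D1, gen 15; leaves L1.d (J3) + L1.e (assembly + comb transfer) of `gen15/SKELETON-D1-hR.v2.1.md`)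

HONEST FRAMING (cell charter, verbatim): «discharging BetaPertH makes Balaban's UV stability UNCONDITIONAL — a real
constructive-QFT result; it is NOT the continuum limit and NOT the Clay problem.»  DERIVED cell leaf (pub-balaban β sub-cell, lane
an2 gen 15); no statement of Bałaban's papers is typed here, no `[cite:]` tag, no `Prop` fact; it instantiates no binder of the
β-function wall by itself.  It DISCHARGES the leaf (L1) «rules 3–4 at j ≥ 1» of the hR skeleton (hypotheses `h3S`/`h4S` of
`SpineRooted.axisReflectionCovariant_flipK_TbalOf_JsBalBmNAtOf_ctrC_candidate`); hR itself still carries (L2) (an3's Wilson law, kernel-done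
elsewhere), (L3) (e3 ff-laws, statement-level) and (L4) (external second-order tables).  NOT `BetaPertH`; NOT continuum; NOT Clay.

## The chain (the `j = 0` chain of `RelInvBorderedHessian` lifted one level; [folklore] throughout)

With `𝕄 := bhKStep d Lc (j+1)` (straight border), `K := KInvStep Lc (j+1)`, `P := piKBm (toSite r) Lc` (so `Π̂_bm = trK P`,
`G := coDressKBmAt = Pᵀ∘K∘P`), `E := axEc (toSite r) Lc`:
* §1 **`comp_comp_bhKStep_KInvStep_piKBm : (𝕄∘K)∘P = piKBmC`** — the (J3) ABSORPTION, entry by entry from the step-residual lemmas: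
  multiplier columns by `comp_bhKStep_KInvStep_inr_inr/_inl_inr` (`StepResidualBorder`/`StepResidualFM`; the mm identity `P_mm = 1`), the
  `(inr, inl)` entries by `comp_bhKStep_KInvStep_inr_inl = 0`, and the `(inl, inl)` entries by the PAIRED field–field identity
  `StepResidualPair.sum_mul_comp_bhKStep_KInvStep_inl_inl` applied to the source `(l, w) ↦ P w z (inl l) (inl β)` = the ROW `(β, z)` of `Π_bm`
  (`GaugeMultiplierBlockMean.isBlockConst_codiff₁_rowBm`: codifferential block-constant; finite window support);
* §2 `comp_bhKStep_coDressKBmAt : 𝕄∘G = piKBmC` (blindness `comp_bhKStep_trK_piKBm` + §1), **`rule4_bhKStep : (E∘𝕄)∘G = E`**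
  (`comp_axEc_piKBmC`); the transposed chain `comp_KInvStep_bhKStep = trK (𝕄∘K)` (`trK = sgnK` for both factors, `sgnK (𝕄∘K) = 𝕄∘K`),
  `comp_coDressKBmAt_bhKStep : G∘𝕄 = trK piKBmC` (left blindness `comp_piKBm_bhKStep`), **`rule3_bhKStep : (G∘𝕄)∘E = E`**;
* §3 **`relInv_coDressKBmAt_KInvStep_succ_bhKStep`** (rules 1–2 from `axEc_rules_coDressKBmAt_KInvStep`) and, by the comb transfer
  `BorderedHessianRooted.relInv_of_combSupported_sub` + `combSupported_bhKStepAt_sub_bhKStep`,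
  **`relInv_coDressKBmAt_KInvStep_succ_bhKStepAt : RelInv G_{j+1} (bhKStepAt d (toSite r) Lc (j+1)) E`** — every in-block root, every `d`,
  every `Lc ≥ 1`, every `j`; with the `j = 0` theorem `relInv_coDressKBmAt_KInvStep_zero_bhKAt`: **`relInv_coDressKBmAt_KInvStep_bhKStepAt`**, ALL `j`.
All declarations `[folklore]`; axioms standard.  Provenance: b2b-balaban β sub-cell, unit beta-an2 gen 15, 2026-08-20 (v1); over `StepResidualPair`
(hence the whole gen-15 chain), `RelInvBorderedHessian`, `BorderedHessianRooted`, `BorderedHessianStep`, `AxialCoordinateProjectorCoarseRules`,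
`BubbleParity` (`trK_KInvStep`) BY NAME; no existing file touched.
-/

open Finset
open scoped BigOperators
open Literature.Probability.LatticeModels (TorusSite Torus.proj Torus.proj_apply)
open Literature.MathematicalPhysics.QuantumFieldTheory
open Literature.MathematicalPhysics.QuantumFieldTheory.Balaban1983to89
open Literature.MathematicalPhysics.QuantumFieldTheory.Balaban1983to89.Beta
open B12Sec2to5 (l1 l1_nonneg)
open ExpKernelCalculus (MKer Decays comp)
open AffineAveraging (Form0 Form1 Form2 box toSite unitVec unitVec_apply dz curv curvAdj codiff₁ contourSum)
open AffineReproduction (contourSumAdj IsBlockConst)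
open KKTFluctuationKernel (delta1 delta1_apply)
open LatticeForm (quo)
open OneStepResolventKernel (Fib KInv quo_zsmul eq_zsmul_quo_of_proj proj_zsmul)
open OneStepKernelFamily (KInvStep decays_KInvStep)
open Summit.QuantumFields.BalabanUV.Beta.TameKernelCalculus
open Summit.QuantumFields.BalabanUV.Beta.ChartConjugationRelative (RelInv)
open Summit.QuantumFields.BalabanUV.Beta.AxialDressingRooted (coDressKBmAt coDressKBmAt_eq spr_coDressKBmAt axEc spr_axEc trK_axEc piKBmC
  piKBmC_inl_inl piKBmC_inl_inr piKBmC_inr_inl piKBmC_inr_inr axEc_rules_coDressKBmAt_KInvStep spr_comp one_le_of_neZero cube mem_cube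
  piKBm piKBm_inl_inl piKBm_inl_inr piKBm_inr_inl piKBm_inr_inr spr_piKBm spr_trK_piKBm)
open Summit.QuantumFields.BalabanUV.Beta.AxialProjectorBlockMean (axProjBmAt)
open Summit.QuantumFields.BalabanUV.Beta.BubbleParity (trK_KInvStep)

namespace Summit.QuantumFields.BalabanUV.Beta.BorderedHessian

noncomputable section

variable {d : ℕ} {Lc : ℕ} [NeZero Lc]

/-! ## §1 (J3) The absorption: `(bhKStep (j+1) ∘ KInvStep Lc (j+1)) ∘ piKBm = piKBmC` -/

/-- [folklore] The row `(β, z)` of `Π_bm`, read as the `(inl ·, inl β)` column of `piKBm` at `z`, IS `rowBm` (window redundancy). -/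
theorem piKBm_col_eq_rowBm {r : Fin (d + 1) → ℕ} (hr : r ∈ box (d + 1) Lc) (β : Fin (d + 1)) (z : Fin (d + 1) → ℤ) :
    (fun l w => piKBm (toSite r) Lc w z (Sum.inl l) (Sum.inl β)) = rowBm (toSite r) Lc β z := by
  funext l w
  rw [piKBm_inl_inl_eq (one_le_of_neZero Lc) hr, rowBm_eq_axProjBmAt]

/-- [folklore] **(J3) THE ABSORPTION**: `comp (comp (bhKStep d Lc (j+1)) (KInvStep Lc (j+1))) (piKBm (toSite r) Lc) = piKBmC (toSite r) Lc`
(in-block root). -/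
theorem comp_comp_bhKStep_KInvStep_piKBm {r : Fin (d + 1) → ℕ} (hr : r ∈ box (d + 1) Lc) (j : ℕ) :
    comp (comp (bhKStep d Lc (j + 1)) (KInvStep (d := d) Lc (j + 1))) (piKBm (toSite r) Lc) = piKBmC (d := d) (toSite r) Lc := by
  classical
  have hLc : 1 ≤ Lc := one_le_of_neZero Lc
  set R : MKer (d + 1) (Fib d) := comp (bhKStep d Lc (j + 1)) (KInvStep (d := d) Lc (j + 1)) with hR
  funext x z a b
  unfold ExpKernelCalculus.comp
  rcases b with β | m
  · -- field columns: the source is the row `(β, z)` of `Π_bm`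
    have e : ∀ w, ∑ f : Fib d, R x w a f * piKBm (toSite r) Lc w z f (Sum.inl β) =
        ∑ l : Fin (d + 1), R x w a (Sum.inl l) * piKBm (toSite r) Lc w z (Sum.inl l) (Sum.inl β) := by
      intro w
      rw [Fintype.sum_sum_type]
      simp only [piKBm_inr_inl, mul_zero, Finset.sum_const_zero, add_zero]
    simp_rw [e]
    rcases a with κ | κ
    · -- (inl, inl): the paired field–field identity with `a := rowBm β z`
      set W : Finset (Fin (d + 1) → ℤ) := (cube (d + 1) Lc).image (fun v => z - v) with hW
      have hout : ∀ w, w ∉ W → ∀ l, piKBm (toSite r) Lc w z (Sum.inl l) (Sum.inl β) = 0 := by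
        intro w hw l
        rw [piKBm_inl_inl, if_neg]
        exact fun h => hw (Finset.mem_image.2 ⟨z - w, h, by abel⟩)
      rw [tsum_eq_sum (s := W) (fun w hw => Finset.sum_eq_zero fun l _ => by rw [hout w hw l, mul_zero])]
      set T : Finset (Fin (d + 1) × (Fin (d + 1) → ℤ)) := (Finset.univ : Finset (Fin (d + 1))) ×ˢ W with hT
      set a : Fin (d + 1) × (Fin (d + 1) → ℤ) → ℝ := fun q => piKBm (toSite r) Lc q.2 z (Sum.inl q.1) (Sum.inl β) with ha
      have hTa : ∀ q, q ∉ T → a q = 0 := by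
        intro q hq
        have hw : q.2 ∉ W := fun h => hq (Finset.mem_product.2 ⟨Finset.mem_univ _, h⟩)
        exact hout q.2 hw q.1
      have hbc : IsBlockConst Lc (codiff₁ (fun l w => a (l, w))) := by
        rw [show (fun l w => a (l, w)) = rowBm (toSite r) Lc β z from piKBm_col_eq_rowBm hr β z]
        exact isBlockConst_codiff₁_rowBm (toSite r) hLc β z
      have hmain := sum_mul_comp_bhKStep_KInvStep_inl_inl (d := d) (Lc := Lc) j T a hTa hbc x κ
      rw [hT, Finset.sum_product, Finset.sum_comm] at hmain
      rw [piKBmC_inl_inl]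
      refine Eq.trans ?_ hmain
      refine Finset.sum_congr rfl fun w _ => Finset.sum_congr rfl fun l _ => ?_
      rw [hR, ha, mul_comm]
    · -- (inr, inl): zero
      rw [piKBmC_inr_inl]
      refine (tsum_congr fun w => ?_).trans tsum_zero
      refine Finset.sum_eq_zero fun l _ => ?_
      rw [hR, comp_bhKStep_KInvStep_inr_inl, zero_mul]
  · -- multiplier columns: `P_mm = 1`
    have e : ∀ w, ∑ f : Fib d, R x w a f * piKBm (toSite r) Lc w z f (Sum.inr m) = if w = z then R x z a (Sum.inr m) else 0 := by
      intro w
      rw [Fintype.sum_sum_type]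
      simp only [piKBm_inl_inr, mul_zero, Finset.sum_const_zero, zero_add, piKBm_inr_inr]
      by_cases hw : w = z
      · subst hw
        rw [if_pos rfl, Finset.sum_eq_single m (fun m' _ hm' => by rw [if_neg (fun h => hm' h.2), mul_zero])
          (fun h => (h (Finset.mem_univ m)).elim), if_pos ⟨rfl, rfl⟩, mul_one]
      · rw [if_neg hw]
        exact Finset.sum_eq_zero fun m' _ => by rw [if_neg (fun h => hw h.1), mul_zero]
    simp_rw [e]
    rw [tsum_eq_single z (fun w hw => if_neg hw), if_pos rfl, hR]
    rcases a with κ | κ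
    · rw [comp_bhKStep_KInvStep_inl_inr, piKBmC_inl_inr]
    · rw [comp_bhKStep_KInvStep_inr_inr, piKBmC_inr_inr]
      by_cases hxz : Torus.proj Lc x = 0 ∧ Torus.proj Lc z = 0
      · rw [if_pos hxz]
        by_cases hq : quo Lc x = quo Lc z ∧ κ = m
        · have hx : x = z := by rw [eq_zsmul_quo_of_proj hxz.1, eq_zsmul_quo_of_proj hxz.2, hq.1]
          rw [if_pos hq, if_pos ⟨hx, hq.2, hxz.1⟩]
        · rw [if_neg hq, if_neg]
          rintro ⟨hx, hκ, -⟩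
          exact hq ⟨by rw [hx], hκ⟩
      · rw [if_neg hxz, if_neg]
        rintro ⟨hx, -, hpx⟩
        exact hxz ⟨hpx, by rw [← hx]; exact hpx⟩

/-! ## §2 Rules 4 and 3 for the straight candidate -/

section Rules

variable {r : Fin (d + 1) → ℕ}

/-- [folklore] The decimated composite resolvent is spread. -/
theorem spr_KInvStep (j : ℕ) : Spr (KInvStep (d := d) Lc j) := by
  obtain ⟨δ, C, hδ, -, h⟩ := decays_KInvStep (d := d) (Lc := Lc) j
  exact ⟨C, δ, hδ, h⟩

/-- [folklore] `bhKStep (j+1) ∘ G_{j+1} = piKBmC` for `G_{j+1} := Π̂_bm (KInvStep Lc (j+1)) Π̂_bmᵀ`: blindness, step residual, absorption. -/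
theorem comp_bhKStep_coDressKBmAt (hr : r ∈ box (d + 1) Lc) (j : ℕ) :
    comp (bhKStep d Lc (j + 1)) (coDressKBmAt (toSite r) Lc (KInvStep (d := d) Lc (j + 1))) = piKBmC (d := d) (toSite r) Lc := by
  have hLc : 1 ≤ Lc := one_le_of_neZero Lc
  have sM : Spr (bhKStep d Lc (j + 1)) := spr_bhKStep (j + 1)
  have sP : Spr (piKBm (d := d) (toSite r) Lc) := spr_piKBm hLc hr
  have sPt : Spr (trK (piKBm (d := d) (toSite r) Lc)) := spr_trK_piKBm hLc hr
  have sK : Spr (KInvStep (d := d) Lc (j + 1)) := spr_KInvStep (j + 1)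
  rw [coDressKBmAt_eq, comp_assoc_tame sM.tame (spr_comp sPt sK).tame sP.tame, comp_assoc_tame sM.tame sPt.tame sK.tame,
    comp_bhKStep_trK_piKBm hr, comp_comp_bhKStep_KInvStep_piKBm hr]

/-- [folklore] **RULE 4 AT STEP `j+1`**: `(axEc ∘ bhKStep (j+1)) ∘ G_{j+1} = axEc`. -/
theorem rule4_bhKStep (hr : r ∈ box (d + 1) Lc) (j : ℕ) :
    comp (comp (axEc (toSite r) Lc) (bhKStep d Lc (j + 1))) (coDressKBmAt (toSite r) Lc (KInvStep (d := d) Lc (j + 1))) =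
      axEc (d := d) (toSite r) Lc := by
  have hLc : 1 ≤ Lc := one_le_of_neZero Lc
  have sE : Spr (axEc (d := d) (toSite r) Lc) := spr_axEc _ _
  have sM : Spr (bhKStep d Lc (j + 1)) := spr_bhKStep (j + 1)
  have sG : Spr (coDressKBmAt (toSite r) Lc (KInvStep (d := d) Lc (j + 1))) := spr_coDressKBmAt hLc hr (spr_KInvStep (j + 1))
  rw [← comp_assoc_tame sE.tame sM.tame sG.tame, comp_bhKStep_coDressKBmAt hr, comp_axEc_piKBmC hLc hr]

/-- [folklore] The step residual has vanishing mixed blocks, so `sgnK` fixes it. -/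
theorem sgnK_comp_bhKStep_KInvStep (j : ℕ) :
    sgnK (comp (bhKStep d Lc (j + 1)) (KInvStep (d := d) Lc (j + 1))) = comp (bhKStep d Lc (j + 1)) (KInvStep (d := d) Lc (j + 1)) :=
  sgnK_eq_self (fun x y κ l => comp_bhKStep_KInvStep_inl_inr j x y κ l) (fun x y κ l => comp_bhKStep_KInvStep_inr_inl j x y κ l)

/-- [folklore] **THE LEFT STEP RESIDUAL IS THE TRANSPOSE OF THE RIGHT ONE**: `KInvStep (j+1) ∘ bhKStep (j+1) = trK (bhKStep (j+1) ∘ KInvStep (j+1))`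
(`trK = sgnK` for both factors: `trK_bhKStep_succ`, `BubbleParity.trK_KInvStep`). -/
theorem comp_KInvStep_bhKStep (j : ℕ) :
    comp (KInvStep (d := d) Lc (j + 1)) (bhKStep d Lc (j + 1)) = trK (comp (bhKStep d Lc (j + 1)) (KInvStep (d := d) Lc (j + 1))) := by
  have h : trK (comp (KInvStep (d := d) Lc (j + 1)) (bhKStep d Lc (j + 1))) = comp (bhKStep d Lc (j + 1)) (KInvStep (d := d) Lc (j + 1)) := by
    rw [trK_comp, trK_bhKStep_succ, trK_KInvStep, comp_sgnK, sgnK_comp_bhKStep_KInvStep]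
  have h' := congrArg trK h
  rwa [trK_trK] at h'

/-- [folklore] `G_{j+1} ∘ bhKStep (j+1) = trK piKBmC` (the transposed chain: left blindness, transposed residual, absorption transposed). -/
theorem comp_coDressKBmAt_bhKStep (hr : r ∈ box (d + 1) Lc) (j : ℕ) :
    comp (coDressKBmAt (toSite r) Lc (KInvStep (d := d) Lc (j + 1))) (bhKStep d Lc (j + 1)) = trK (piKBmC (d := d) (toSite r) Lc) := by
  have hLc : 1 ≤ Lc := one_le_of_neZero Lc
  have sM : Spr (bhKStep d Lc (j + 1)) := spr_bhKStep (j + 1)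
  have sP : Spr (piKBm (d := d) (toSite r) Lc) := spr_piKBm hLc hr
  have sPt : Spr (trK (piKBm (d := d) (toSite r) Lc)) := spr_trK_piKBm hLc hr
  have sK : Spr (KInvStep (d := d) Lc (j + 1)) := spr_KInvStep (j + 1)
  rw [coDressKBmAt_eq, ← comp_assoc_tame (spr_comp sPt sK).tame sP.tame sM.tame, comp_piKBm_bhKStep hr,
    ← comp_assoc_tame sPt.tame sK.tame sM.tame, comp_KInvStep_bhKStep, ← trK_comp, comp_comp_bhKStep_KInvStep_piKBm hr]

/-- [folklore] **RULE 3 AT STEP `j+1`**: `(G_{j+1} ∘ bhKStep (j+1)) ∘ axEc = axEc`. -/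
theorem rule3_bhKStep (hr : r ∈ box (d + 1) Lc) (j : ℕ) :
    comp (comp (coDressKBmAt (toSite r) Lc (KInvStep (d := d) Lc (j + 1))) (bhKStep d Lc (j + 1))) (axEc (toSite r) Lc) =
      axEc (d := d) (toSite r) Lc := by
  rw [comp_coDressKBmAt_bhKStep hr, comp_trK_piKBmC_axEc (one_le_of_neZero Lc) hr]

/-! ## §3 The relative inverse at every step, straight and rooted -/

/-- [folklore] **`RelInv G_{j+1} (bhKStep d Lc (j+1)) (axEc (toSite r) Lc)`** — all four rules for the straight candidate. -/
theorem relInv_coDressKBmAt_KInvStep_succ_bhKStep (hr : r ∈ box (d + 1) Lc) (j : ℕ) :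
    RelInv (coDressKBmAt (toSite r) Lc (KInvStep (d := d) Lc (j + 1))) (bhKStep d Lc (j + 1)) (axEc (toSite r) Lc) := by
  obtain ⟨h1, h2⟩ := axEc_rules_coDressKBmAt_KInvStep (d := d) hr (j + 1)
  exact ⟨h1, h2, rule3_bhKStep hr j, rule4_bhKStep hr j⟩

/-- [folklore] **`RelInv G_{j+1} (bhKStepAt d (toSite r) Lc (j+1)) (axEc (toSite r) Lc)`** — the ROOTED candidate of `BorderedHessianStep`, by the
comb transfer (`relInv_of_combSupported_sub`, `combSupported_bhKStepAt_sub_bhKStep`). -/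
theorem relInv_coDressKBmAt_KInvStep_succ_bhKStepAt (hr : r ∈ box (d + 1) Lc) (j : ℕ) :
    RelInv (coDressKBmAt (toSite r) Lc (KInvStep (d := d) Lc (j + 1))) (bhKStepAt d (toSite r) Lc (j + 1)) (axEc (toSite r) Lc) :=
  relInv_of_combSupported_sub (spr_coDressKBmAt (one_le_of_neZero Lc) hr (spr_KInvStep (j + 1))) (spr_bhKStep (j + 1))
    (spr_bhKStepAt hr (j + 1)) (relInv_coDressKBmAt_KInvStep_succ_bhKStep hr j) (combSupported_bhKStepAt_sub_bhKStep hr j)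

/-- [folklore] **THE RELATIVE INVERSE AT EVERY STEP** `j` (the `j = 0` case is `BorderedHessianRooted.relInv_coDressKBmAt_KInvStep_zero_bhKAt`). -/
theorem relInv_coDressKBmAt_KInvStep_bhKStepAt (hr : r ∈ box (d + 1) Lc) :
    ∀ j : ℕ, RelInv (coDressKBmAt (toSite r) Lc (KInvStep (d := d) Lc j)) (bhKStepAt d (toSite r) Lc j) (axEc (toSite r) Lc)
  | 0 => by rw [bhKStepAt_zero]; exact relInv_coDressKBmAt_KInvStep_zero_bhKAt hr
  | j + 1 => relInv_coDressKBmAt_KInvStep_succ_bhKStepAt hr j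

end Rules

end

end Summit.QuantumFields.BalabanUV.Beta.BorderedHessian
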